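/-
Copyright (c) 2026 the pub-hodgecm-mathlib formalisation cell (harness21).  Prover seat hodgecm-mathlib-K2Liu-p10 (g4), Track B «K2-LIT»,
#184♮ = hLiu418 = `stmt-HodgeConjecture-24832`; organ S2 «ARCH SPAN BY K-TYPE PATHS», file S2-K K-1 (LEAD F0P6-plan (g14) RULING M-158f, BATCH #10 (3) GO;
DESIGN-S2 41bd43fff4457fcc §3 (i); ref1 TESTVECTORS-S2T 663341ae91317f68 (n1) «S2-K should EXPORT the memberships»).  KERNEL: theorems only.
-/
import Summits.HodgeConjecture.HodgeConjecture.Theorems.K2LiuU22CompactPictureDefs   -- ★ p860097 S2-K DEFS leaf (`Carrier`, `uMat`, `dz`, `bil`, `kType`, `fkl`, `hk`)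
import Mathlib.LinearAlgebra.Vandermonde
import Mathlib.LinearAlgebra.Matrix.NonsingularInverse
import Mathlib.Algebra.Polynomial.Derivative
import Mathlib.Algebra.Polynomial.AlgebraMap
import HarnessLib

/-!
# Crux `HLiu418`, organ S2, file S2-K K-1: POLARISATION AND THE K-TYPE MEMBERSHIPS
# (`u₀₀^k u₁₀ D^l`, `u₀₀^k u₀₁ D^l`, `H_k D^l ∈ W_{(k+1+l, l)}` — the right-hand sides of the eight transition identities of S2-T)

Cell `hodgecm-mathlib`, crux item hLiu418 = `stmt-HodgeConjecture-24832`, route of record `HCCMUnconditional`; squad K2 ∕ K2Liu, prover K2Liu-p10 (g4).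
THEOREMS ONLY (no `def`, no `instance`, no notation, no named-fact hypothesis, no `sorry`); lane `--supports stmt-HodgeConjecture-24832 --as helper`.

The K-type `W_{(k+l,l)} = kType k l = D^l · span_ℂ{(ξ·u·η)^k}` (★ DEFS leaf) is spanned by `d`-th powers of the rank-one forms `ξ·u·η`; the classical POLARISATION
argument (char `0`, Vandermonde) shows that every coefficient of `(ξ·u·η)^k` as a polynomial in `ξ, η` lies in the span — in particular the monomials that occur
on the right-hand sides of ref1's eight transition identities (TESTVECTORS-S2T §1 «K-TYPE BOOKKEEPING», (n1)) [KashiwaraVergne1978, §II.5; Howe1989Remarks, §2]: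
* §1 (any commutative `ℂ`-algebra `R`) **`coeff_mem_of_eval_mem`**: if a polynomial `p ∈ R[X]` of degree `≤ d` takes values in a `ℂ`-subspace `S` at every scalar
  `c ∈ ℂ`, then every coefficient of `p` lies in `S` (Vandermonde at the nodes `0, 1, …, d`);
* §2 the two coefficient computations `coeff_zero_linPow_mul_lin`, `coeff_one_linPow_mul_lin` for `z·(yX + x)^a·(y′X + x′)` and the degree bound;
* §3 (the carrier) the bilinear bookkeeping `bil_single_add_smul` and **THE MEMBERSHIPS**: `dz_mul_u00_pow_mem` (`D^l u₀₀^d ∈ W d l`),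
  **`dz_mul_u00_pow_mul_u10_mem`**, **`dz_mul_u00_pow_mul_u01_mem`** (`D^l u₀₀^k u₁₀, D^l u₀₀^k u₀₁ ∈ W (k+1) l`), **`dz_mul_hk_mem`** (`D^l H_k ∈ W (k+1) l`,
  `H_k = u₀₀^k u₁₁ + k u₀₀^{k−1} u₀₁ u₁₀` — the `ξ₀^kξ₁η₀^kη₁`-coefficient of `(ξuη)^{k+1}` up to `k+1`); with `l ↦ l−1` and `k ↦ k−1` these are the TEN memberships of (n1).
NOT here: stability of `kType` under `rOp`∕`lOp` (K-1b), the decomposition and the structure lemma (K-2), the chain rule (K-3).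

HONEST LABEL: HC_CM is proved only modulo the 7 printed citations (2 remaining named inputs: hLiu418 = stmt-HodgeConjecture-24832, h413 = stmt-HodgeConjecture-24833)
until rung 0 closes; helper, closes no item.
References: [KashiwaraVergne1978] M. Kashiwara, M. Vergne, Invent. Math. 44 (1978) §II.5; [Howe1989Remarks] R. Howe, Trans. AMS 313 (1989) §2;
[LeeZhu1998] S. T. Lee, C.-B. Zhu, Trans. AMS 350 (1998) p. 5032 (the K-types `V_λ`, multiplicity one).
-/

set_option autoImplicit false
set_option linter.dupNamespace false -- the mandated namespace repeats `HodgeConjecture.HodgeConjecture`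

noncomputable section

open Polynomial Matrix
open Summit.HodgeConjecture.HodgeConjecture.Cruxes.HLiu418.K2LiuU22CompactPictureDefs

namespace Summit.HodgeConjecture.HodgeConjecture.Cruxes.HLiu418.K2LiuU22KTypeMembership

/-! ## §1 Polarisation: coefficients of a polynomial from its values at scalars -/

section Polarisation

variable {R : Type*} [CommRing R] [Algebra ℂ R]

/-- a polynomial of degree `≤ d` evaluated at a scalar is `Σ_{m ≤ d} c^m • coeff m`. [folklore] -/
theorem eval_algebraMap_eq_sum_smul_coeff (p : R[X]) {d : ℕ} (hd : p.natDegree ≤ d) (c : ℂ) :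
    p.eval (algebraMap ℂ R c) = ∑ m : Fin (d + 1), c ^ (m : ℕ) • p.coeff m := by
  rw [Polynomial.eval_eq_sum_range' (Nat.lt_succ_of_le hd), Finset.sum_range (fun i => p.coeff i * algebraMap ℂ R c ^ i)]
  refine Finset.sum_congr rfl fun m _ => ?_
  rw [Algebra.smul_def, map_pow, mul_comm]

/-- **POLARISATION (Vandermonde, characteristic `0`)**: if `p ∈ R[X]` has degree `≤ d` and `p(c) ∈ S` for every scalar `c ∈ ℂ` (`S` a `ℂ`-subspace of `R`), then every
coefficient of `p` lies in `S` — the nodes `0, 1, …, d` are distinct, so the Vandermonde system is invertible and each coefficient is a `ℂ`-combination of values.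
[cite: KashiwaraVergne1978, §II.5] [cite: Howe1989Remarks, §2] -/
theorem coeff_mem_of_eval_mem (S : Submodule ℂ R) (p : R[X]) {d : ℕ} (hd : p.natDegree ≤ d) (h : ∀ c : ℂ, p.eval (algebraMap ℂ R c) ∈ S) (n : ℕ) :
    p.coeff n ∈ S := by
  by_cases hlt : d < n
  · rw [Polynomial.coeff_eq_zero_of_natDegree_lt (lt_of_le_of_lt hd hlt)]
    exact S.zero_mem
  have hn : n ≤ d := not_lt.1 hlt
  let v : Fin (d + 1) → ℂ := fun i => ((i : ℕ) : ℂ)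
  have hv : Function.Injective v := fun i j hij => Fin.ext (Nat.cast_injective (R := ℂ) hij)
  have hdet : (Matrix.vandermonde v).det ≠ 0 := Matrix.det_vandermonde_ne_zero_iff.2 hv
  let n' : Fin (d + 1) := ⟨n, Nat.lt_succ_of_le hn⟩
  let w : Fin (d + 1) → ℂ := Pi.single n' (1 : ℂ) ᵥ* (Matrix.vandermonde v)⁻¹
  have hw : w ᵥ* Matrix.vandermonde v = Pi.single n' 1 := by
    show (Pi.single n' (1 : ℂ) ᵥ* (Matrix.vandermonde v)⁻¹) ᵥ* Matrix.vandermonde v = Pi.single n' 1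
    rw [Matrix.vecMul_vecMul, Matrix.nonsing_inv_mul _ (isUnit_iff_ne_zero.2 hdet), Matrix.vecMul_one]
  have hw' : ∀ m : Fin (d + 1), ∑ i, w i * v i ^ (m : ℕ) = (Pi.single n' (1 : ℂ) : Fin (d + 1) → ℂ) m := fun m => by
    have e := congr_fun hw m
    simpa [Matrix.vecMul, dotProduct, Matrix.vandermonde_apply] using e
  have hsum : ∑ i, w i • p.eval (algebraMap ℂ R (v i)) = p.coeff n := by
    simp_rw [eval_algebraMap_eq_sum_smul_coeff p hd, Finset.smul_sum, smul_smul]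
    rw [Finset.sum_comm]
    have hm : ∀ m : Fin (d + 1), ∑ i, (w i * v i ^ (m : ℕ)) • p.coeff m = (Pi.single n' (1 : ℂ) : Fin (d + 1) → ℂ) m • p.coeff m := fun m => by
      rw [← Finset.sum_smul, hw' m]
    simp_rw [hm]
    rw [Finset.sum_eq_single n' (fun m _ hm' => by rw [Pi.single_eq_of_ne hm', zero_smul]) (fun h' => absurd (Finset.mem_univ n') h'),
      Pi.single_eq_same, one_smul]
  rw [← hsum]
  exact S.sum_mem fun i _ => S.smul_mem _ (h _)

/-! ## §2 The two coefficients of `z·(yX + x)^a·(y′X + x′)` -/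

omit [Algebra ℂ R] in
/-- degree bound: `z·(yX + x)^a·(y′X + x′)` has degree `≤ a + 1`. [folklore] -/
theorem natDegree_linPow_mul_lin_le (z x y x' y' : R) (a : ℕ) : (C z * (C y * X + C x) ^ a * (C y' * X + C x')).natDegree ≤ a + 1 := by
  refine (Polynomial.natDegree_mul_le).trans (add_le_add ((Polynomial.natDegree_mul_le).trans ?_) (Polynomial.natDegree_linear_le))
  rw [Polynomial.natDegree_C, zero_add]
  exact (Polynomial.natDegree_pow_le).trans (by simpa using Nat.mul_le_mul_left a (Polynomial.natDegree_linear_le (a := y) (b := x)))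

/-- evaluation at a scalar: `z·(x + c y)^a·(x′ + c y′)`. [folklore] -/
theorem eval_linPow_mul_lin (z x y x' y' : R) (a : ℕ) (c : ℂ) :
    (C z * (C y * X + C x) ^ a * (C y' * X + C x')).eval (algebraMap ℂ R c) = z * (x + c • y) ^ a * (x' + c • y') := by
  simp only [eval_mul, eval_pow, eval_add, eval_C, eval_X, Algebra.smul_def]
  ring

omit [Algebra ℂ R] in
/-- the constant coefficient: `z·x^a·x′`. [folklore] -/
theorem coeff_zero_linPow_mul_lin (z x y x' y' : R) (a : ℕ) : (C z * (C y * X + C x) ^ a * (C y' * X + C x')).coeff 0 = z * x ^ a * x' := by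
  simp [Polynomial.coeff_zero_eq_eval_zero]

omit [Algebra ℂ R] in
/-- the linear coefficient: `z·(a·x^{a−1}·y·x′ + x^a·y′)` (the factor `a` in front makes `a = 0` need no side condition). [folklore] -/
theorem coeff_one_linPow_mul_lin (z x y x' y' : R) (a : ℕ) :
    (C z * (C y * X + C x) ^ a * (C y' * X + C x')).coeff 1 = z * ((a : R) * x ^ (a - 1) * y * x' + x ^ a * y') := by
  have h := Polynomial.coeff_derivative (C z * (C y * X + C x) ^ a * (C y' * X + C x')) 0
  rw [zero_add, Nat.cast_zero, zero_add, mul_one] at h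
  rw [← h, Polynomial.coeff_zero_eq_eval_zero]
  simp only [derivative_mul, derivative_pow, derivative_add, derivative_C, derivative_X, zero_mul, zero_add, mul_one, add_zero,
    eval_mul, eval_add, eval_pow, eval_C, eval_X, eval_natCast, mul_zero, map_natCast]
  ring

/-- **the two polarisation identities packaged**: if `z·(x + c y)^a·(x′ + c y′) ∈ S` for every `c ∈ ℂ`, then `z·x^a·x′ ∈ S` and `z·(a x^{a−1} y x′ + x^a y′) ∈ S`.
[cite: KashiwaraVergne1978, §II.5] -/
theorem mem_of_forall_linPow_mul_lin_mem (S : Submodule ℂ R) (z x y x' y' : R) (a : ℕ) (h : ∀ c : ℂ, z * (x + c • y) ^ a * (x' + c • y') ∈ S) :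
    z * x ^ a * x' ∈ S ∧ z * ((a : R) * x ^ (a - 1) * y * x' + x ^ a * y') ∈ S := by
  have h' : ∀ c : ℂ, (C z * (C y * X + C x) ^ a * (C y' * X + C x')).eval (algebraMap ℂ R c) ∈ S := fun c => by
    rw [eval_linPow_mul_lin]; exact h c
  refine ⟨?_, ?_⟩
  · rw [← coeff_zero_linPow_mul_lin z x y x' y' a]
    exact coeff_mem_of_eval_mem S _ (natDegree_linPow_mul_lin_le z x y x' y' a) h' 0
  · rw [← coeff_one_linPow_mul_lin z x y x' y' a]
    exact coeff_mem_of_eval_mem S _ (natDegree_linPow_mul_lin_le z x y x' y' a) h' 1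

end Polarisation

/-! ## §3 The memberships in `W_{(k+1+l, l)} = kType (k+1) l` -/

section Memberships

/-- the rank-one form at `ξ = e₀ + c e₁`, `η = e₀ + c′ e₁`: `ξ·u·η = (u₀₀ + c′u₀₁) + c (u₁₀ + c′u₁₁)`. [cite: KashiwaraVergne1978, §II.5] -/
theorem bil_single_add_smul {R : Type*} [CommRing R] [Algebra ℂ R] (u : Matrix (Fin 2) (Fin 2) R) (c c' : ℂ) :
    bil u (Pi.single 0 1 + Pi.single 1 c) (Pi.single 0 1 + Pi.single 1 c') = (u 0 0 + c' • u 0 1) + c • (u 1 0 + c' • u 1 1) := by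
  simp only [bil, Fin.sum_univ_two, Pi.add_apply, Pi.single_eq_same, Pi.single_eq_of_ne (zero_ne_one : (0 : Fin 2) ≠ 1),
    Pi.single_eq_of_ne (one_ne_zero : (1 : Fin 2) ≠ 0), add_zero, zero_add, one_mul, mul_one, Algebra.smul_def, map_mul, map_one]
  ring

/-- for all scalars `c, c′`: `D^l · ((u₀₀ + c′u₀₁) + c (u₁₀ + c′u₁₁))^d ∈ W d l` (a generator). [cite: KashiwaraVergne1978, §II.5] -/
theorem dz_mul_lin_pow_mem (d : ℕ) (l : ℤ) (c c' : ℂ) : dz l * ((uMat 0 0 + c' • uMat 0 1) + c • (uMat 1 0 + c' • uMat 1 1)) ^ d ∈ kType d l := by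
  rw [← bil_single_add_smul uMat c c']
  exact dz_mul_bil_pow_mem_kType d l _ _

/-- **`D^l · u₀₀^d ∈ W_{(d+l, l)}`** (the highest-weight line, any order of the factors). [cite: LeeZhu1998, p. 5032] -/
theorem dz_mul_u00_pow_mem (d : ℕ) (l : ℤ) : dz l * uMat 0 0 ^ d ∈ kType d l := by
  have h := fkl_mem_kType d l
  rwa [fkl_apply, mul_comm] at h

/-- for every `c′`: `D^l · (u₀₀ + c′u₀₁)^k · (u₁₀ + c′u₁₁) ∈ W (k+1) l` (`ξ`-polarisation: the `c¹`-coefficient of the generator is `(k+1)` times it).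
[cite: KashiwaraVergne1978, §II.5] -/
theorem dz_mul_linPow_mul_lin_mem (k : ℕ) (l : ℤ) (c' : ℂ) : dz l * (uMat 0 0 + c' • uMat 0 1) ^ k * (uMat 1 0 + c' • uMat 1 1) ∈ kType (k + 1) l := by
  -- the generator as `z·(x + c y)^{k+1}·(1 + c·0)`
  have h := (mem_of_forall_linPow_mul_lin_mem (kType (k + 1) l) (dz l) (uMat 0 0 + c' • uMat 0 1) (uMat 1 0 + c' • uMat 1 1) 1 0 (k + 1) fun c => by
    rw [smul_zero, add_zero, mul_one]; exact dz_mul_lin_pow_mem (k + 1) l c c').2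
  rw [Nat.add_sub_cancel, mul_one, mul_zero, add_zero, Nat.cast_add, Nat.cast_one] at h
  -- divide by `k + 1 ≠ 0`
  have hk : ((k : ℂ) + 1) ≠ 0 := by exact_mod_cast Nat.succ_ne_zero k
  have e1 : ((k : Carrier) + 1) = algebraMap ℂ Carrier ((k : ℂ) + 1) := by rw [map_add, map_natCast, map_one]
  have e : dz l * (((k : Carrier) + 1) * (uMat 0 0 + c' • uMat 0 1) ^ k * (uMat 1 0 + c' • uMat 1 1)) =
      ((k : ℂ) + 1) • (dz l * (uMat 0 0 + c' • uMat 0 1) ^ k * (uMat 1 0 + c' • uMat 1 1)) := by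
    rw [e1, mul_assoc (algebraMap ℂ Carrier _), ← Algebra.smul_def, mul_smul_comm, ← mul_assoc]
  rw [e] at h
  have h2 := (kType (k + 1) l).smul_mem (((k : ℂ) + 1)⁻¹) h
  rwa [inv_smul_smul₀ hk] at h2

/-- **`D^l · u₀₀^k u₁₀ ∈ W_{(k+1+l, l)}`** (`λ + e₁` resp. `λ − e₂` bookkeeping of (n1) with `l ↦ l−1`). [cite: KashiwaraVergne1978, §II.5] [cite: LeeZhu1998, p. 5032] -/
theorem dz_mul_u00_pow_mul_u10_mem (k : ℕ) (l : ℤ) : dz l * (uMat 0 0 ^ k * uMat 1 0) ∈ kType (k + 1) l := by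
  have h := dz_mul_linPow_mul_lin_mem k l 0
  rwa [zero_smul, zero_smul, add_zero, add_zero, mul_assoc] at h

/-- **`D^l · u₀₀^k u₀₁ ∈ W_{(k+1+l, l)}`** (`η`-polarisation of `D^l (u₀₀ + c′u₀₁)^{k+1}`). [cite: KashiwaraVergne1978, §II.5] [cite: LeeZhu1998, p. 5032] -/
theorem dz_mul_u00_pow_mul_u01_mem (k : ℕ) (l : ℤ) : dz l * (uMat 0 0 ^ k * uMat 0 1) ∈ kType (k + 1) l := by
  have h := (mem_of_forall_linPow_mul_lin_mem (kType (k + 1) l) (dz l) (uMat 0 0) (uMat 0 1) 1 0 (k + 1) fun c' => by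
    rw [smul_zero, add_zero, mul_one]
    have h0 := dz_mul_lin_pow_mem (k + 1) l 0 c'
    rwa [zero_smul, add_zero] at h0).2
  rw [Nat.add_sub_cancel, mul_one, mul_zero, add_zero, Nat.cast_add, Nat.cast_one] at h
  have hk : ((k : ℂ) + 1) ≠ 0 := by exact_mod_cast Nat.succ_ne_zero k
  have e1 : ((k : Carrier) + 1) = algebraMap ℂ Carrier ((k : ℂ) + 1) := by rw [map_add, map_natCast, map_one]
  have e : dz l * (((k : Carrier) + 1) * uMat 0 0 ^ k * uMat 0 1) = ((k : ℂ) + 1) • (dz l * (uMat 0 0 ^ k * uMat 0 1)) := by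
    rw [e1, mul_assoc (algebraMap ℂ Carrier _), ← Algebra.smul_def, mul_smul_comm]
  rw [e] at h
  have h2 := (kType (k + 1) l).smul_mem (((k : ℂ) + 1)⁻¹) h
  rwa [inv_smul_smul₀ hk] at h2

/-- **`D^l · H_k ∈ W_{(k+1+l, l)}`**, `H_k = u₀₀^k u₁₁ + k·u₀₀^{k−1} u₀₁ u₁₀` (the harmonic companion of ★ `hk`; `η`-polarisation of `dz_mul_linPow_mul_lin_mem`).
[cite: KashiwaraVergne1978, §II.5] [cite: LeeZhu1998, p. 5032] -/
theorem dz_mul_hk_mem (k : ℕ) (l : ℤ) : dz l * hk uMat k ∈ kType (k + 1) l := by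
  have h := (mem_of_forall_linPow_mul_lin_mem (kType (k + 1) l) (dz l) (uMat 0 0) (uMat 0 1) (uMat 1 0) (uMat 1 1) k fun c' =>
    dz_mul_linPow_mul_lin_mem k l c').2
  have e : dz l * ((k : Carrier) * uMat 0 0 ^ (k - 1) * uMat 0 1 * uMat 1 0 + uMat 0 0 ^ k * uMat 1 1) = dz l * hk uMat k := by
    rw [hk_apply, Nat.cast_smul_eq_nsmul ℂ, nsmul_eq_mul]
    ring
  rwa [e] at h

/-- the same four with the factors in the order `monomial · D^l` (as S2-T's right-hand sides are written). [cite: LeeZhu1998, p. 5032] -/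
theorem u00_pow_mul_dz_mem (d : ℕ) (l : ℤ) : uMat 0 0 ^ d * dz l ∈ kType d l := by
  rw [mul_comm]; exact dz_mul_u00_pow_mem d l

/-- `u₀₀^k u₁₀ D^l ∈ W (k+1) l`. [cite: LeeZhu1998, p. 5032] -/
theorem u00_pow_mul_u10_mul_dz_mem (k : ℕ) (l : ℤ) : uMat 0 0 ^ k * uMat 1 0 * dz l ∈ kType (k + 1) l := by
  rw [mul_comm]; exact dz_mul_u00_pow_mul_u10_mem k l

/-- `u₀₀^k u₀₁ D^l ∈ W (k+1) l`. [cite: LeeZhu1998, p. 5032] -/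
theorem u00_pow_mul_u01_mul_dz_mem (k : ℕ) (l : ℤ) : uMat 0 0 ^ k * uMat 0 1 * dz l ∈ kType (k + 1) l := by
  rw [mul_comm]; exact dz_mul_u00_pow_mul_u01_mem k l

/-- `H_k D^l ∈ W (k+1) l`. [cite: LeeZhu1998, p. 5032] -/
theorem hk_mul_dz_mem (k : ℕ) (l : ℤ) : hk uMat k * dz l ∈ kType (k + 1) l := by
  rw [mul_comm]; exact dz_mul_hk_mem k l

end Memberships

end Summit.HodgeConjecture.HodgeConjecture.Cruxes.HLiu418.K2LiuU22KTypeMembership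

end
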